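import Summits.AtomisticToContinuum.BoseEinsteinCondensation.Theses.BECProbeMassFlow
import Summits.AtomisticToContinuum.BoseEinsteinCondensation.Theorems.BECProbeMassFlowCloudMomentumAtomFreeZeroMomentum
import Summits.AtomisticToContinuum.BoseEinsteinCondensation.Theorems.BECProbeMassFlowCloudMomentumAtomProjectionTransfer
import Literature.MathematicalPhysics.QuantumManyBody.PeriodicBoseGasImpurityTranslation
import Literature.MathematicalPhysics.QuantumManyBody.BoseGasThermodynamicLimitProofs
import Literature.MathematicalPhysics.QuantumManyBody.BoseGasThermodynamicLimitRuelle
import Literature.MathematicalPhysics.QuantumManyBody.PeriodicBoseGasThm31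
import HarnessLib

/-!
# Finite pinned-scatterer energies at small density, hard cores included

Helper file for the crux `BECProbeMassFlow.CloudMomentumAtom` (item stmt-AtomisticToContinuum-12310),
line `registered` (skeleton `Cruxes/CloudMomentumAtom/Lines/birth.lean`), stub `stub_andersonFidelity`
(the lead's stub). The crux and the stub both quantify over `δ`-near-minimisers of the
pinned-scatterer energy `impurityPeriodicEnergy v 0 Φ` on the torus of side `sideLength ρ (N + 1)`;
with an INFINITE infimum every state would be a near-minimiser and both conclusions fail (a boosted
state has `w₀ = 0`), so every proof of either must first know

  `impurityPeriodicGroundStateEnergy v N (sideLength ρ (N + 1)) 0 < ⊤` for `0 < ρ < ρ₁(v)`, eventually in `N`,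

for EVERY repulsive finite-range `v` — hard cores (`v = ⊤` near `0`) included, where the bounded
criterion `impurityPeriodicGroundStateEnergy_ne_top` is void. This is the "hidden content" recorded
on the crux by its refuter (old support item stmt-AtomisticToContinuum-3909 of the retired sibling
route, closed moot and never proved). We prove it here (`eventually_impurityPeriodicGroundStateEnergy_lt_top`)
and register it as the stub **`stub_impurityEnergyFinite`** of the reshaped skeleton (statement verbatim), and we
land the line's sorry-free COMPOSITION: `andersonFidelity_of_finite` (finiteness + Anderson fidelity given
finiteness ⇒ the original Anderson-fidelity stub), `cloudMomentumAtom_of_stubs` (the three birth stubs ⇒ the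
crux body, verbatim from the checked skeleton) and `cloudMomentumAtom_of_andersonFidelityOfFinite`
(**`AndersonFidelityOfFinite → CloudMomentumAtom`**, the crux decl concluded BY NAME from the single remaining
registered stub `stub_andersonFidelityOfFinite`, using the LANDED stubs `stub_freeZeroMomentum`,
`stub_projectionTransfer` and `stub_impurityEnergyFinite`): the kernel-checked reduction of the crux to the
route's Transfer `C⁺` stripped of its hidden finiteness content.

## Proof

Let `R > 0` be a range of `v`. Periodise a Dirichlet trial state `Ψ` of the box `Λ_{L₀} = (0, L₀)³`
to the torus of side `L ≥ L₀ + 2R + 2` (`TrialState.toPeriodic`): its periodic energy is at most the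
Dirichlet energy (`TrialState.periodicEnergy_toPeriodic_le`, no image interactions), and a scatterer
pinned at the point `x₀ = (L₀ + R + 1)·(1,1,1)` is farther than `R` from every particle of the box
and from all their lattice images (`lt_norm_sub_shift_sub_latticeVec`), so the impurity term of
`impurityPeriodicEnergy v x₀` vanishes on the state. Hence
`E_imp(N, L, x₀) ≤ E₀^D(N, L₀)` (`impurityPeriodicGroundStateEnergy_shift_le_groundStateEnergy`), and
`E_imp(N, L, 0) = E_imp(N, L, x₀)` by translation invariance on the torus
(`impurityPeriodicGroundStateEnergy_eq_of_position`). Along the box sequences: with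
`L₀ = sideLength (2ρ) N` (Dirichlet box at the double density) and `L = sideLength ρ (N + 1) ≥ sideLength ρ N`,
the gap `sideLength ρ N − sideLength (2ρ) N → ∞` exceeds `2R + 2` eventually
(`tendsto_sideLength_sub_sideLength`), and `E₀^D(N, sideLength (2ρ) N) < ⊤` eventually as soon as
`2ρ(1 + R)³ < 1` (`limsup_lt_top_of_small`, Ruelle's padded product states). No new definitions.
-/

noncomputable section

open MeasureTheory Filter
open scoped ENNReal NNReal ComplexConjugate BigOperators

namespace Summit.AtomisticToContinuum.BoseEinsteinCondensation.Cruxes.CloudMomentumAtom.Birth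

open Literature.MathematicalPhysics.QuantumManyBody.BoseGas

variable {N : ℕ}

/-! ### Geometry: the shifted scatterer is far from the box and from all its images -/

/-- **Separation from the images.** If `0 < y₀ < L₀` (a coordinate of a particle in the box
`(0, L₀)³`), `c = L₀ + R + 1` (the corresponding coordinate of the shifted scatterer), `0 < L` and
`L₀ + 2R + 2 ≤ L`, then `|y₀ - c - L m| > R` for every integer `m`. [folklore] -/
theorem lt_abs_sub_shift_sub_mul {y₀ L₀ R L : ℝ} (hy0 : 0 < y₀) (hyL : y₀ < L₀) (hR : 0 ≤ R)
    (hL : 0 < L) (hLL : L₀ + 2 * R + 2 ≤ L) (m : ℤ) :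
    R < |y₀ - (L₀ + R + 1) - L * m| := by
  rcases lt_trichotomy m 0 with hm | hm | hm
  · have hm1 : m ≤ -1 := by omega
    have hm' : (m : ℝ) ≤ -1 := by exact_mod_cast hm1
    have hLm : L * m ≤ -L := by nlinarith
    exact lt_abs.2 (Or.inl (by linarith))
  · subst hm
    simp only [Int.cast_zero, mul_zero, sub_zero]
    exact lt_abs.2 (Or.inr (by linarith))
  · have hm' : (1 : ℝ) ≤ m := by exact_mod_cast hm
    have hLm : L ≤ L * m := by nlinarith
    exact lt_abs.2 (Or.inr (by linarith))

/-- **The shifted scatterer is out of range of the whole box, images included**: for `y` in the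
open box `(0, L₀)³`, `x₀ = (L₀ + R + 1)(1,1,1)`, `0 < L`, `L₀ + 2R + 2 ≤ L` and every `n ∈ ℤ³`,
`R < ‖y - x₀ - L n‖` (already the first coordinate is farther than `R`). [folklore] -/
theorem lt_norm_sub_shift_sub_latticeVec {L₀ R L : ℝ} (hR : 0 ≤ R) (hL : 0 < L)
    (hLL : L₀ + 2 * R + 2 ≤ L) {y : Space} (hy : y ∈ box L₀) (n : Fin 3 → ℤ) :
    R < ‖y - (WithLp.toLp 2 fun _ : Fin 3 => L₀ + R + 1 : Space) - latticeVec L n‖ := by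
  have h0 := hy 0
  rw [Set.mem_Ioo] at h0
  have hcoord : R < |y 0 - (L₀ + R + 1) - L * n 0| :=
    lt_abs_sub_shift_sub_mul h0.1 h0.2 hR hL hLL (n 0)
  calc R < |y 0 - (L₀ + R + 1) - L * n 0| := hcoord
    _ = ‖(y - (WithLp.toLp 2 fun _ : Fin 3 => L₀ + R + 1 : Space) - latticeVec L n) 0‖ := by
        rw [Real.norm_eq_abs]
        simp [latticeVec]
    _ ≤ ‖y - (WithLp.toLp 2 fun _ : Fin 3 => L₀ + R + 1 : Space) - latticeVec L n‖ :=
        PiLp.norm_apply_le _ 0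

/-- Hence the periodised potential of the shifted scatterer vanishes on the box: for `v` of range
`R` and `y ∈ (0, L₀)³`, `v^per_L(y - x₀) = 0`. [folklore] -/
theorem periodizedPotential_sub_shift_eq_zero {v : ℝ → ℝ≥0∞} {L₀ R L : ℝ}
    (hv : ∀ r, R < r → v r = 0) (hR : 0 ≤ R) (hL : 0 < L) (hLL : L₀ + 2 * R + 2 ≤ L)
    {y : Space} (hy : y ∈ box L₀) :
    periodizedPotential v L (y - (WithLp.toLp 2 fun _ : Fin 3 => L₀ + R + 1 : Space)) = 0 := by
  unfold periodizedPotential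
  exact ENNReal.tsum_eq_zero.2 fun n => hv _ (lt_norm_sub_shift_sub_latticeVec hR hL hLL hy n)

/-! ### The comparison `E_imp(N, L, x₀) ≤ E₀^D(N, L₀)` -/

/-- **The impurity term vanishes on a periodised Dirichlet state.** For `v` of range `R`,
`0 < L`, `L₀ ≤ L`, `L₀ + 2R + 2 ≤ L` and a Dirichlet trial state `Ψ` of `Λ_{L₀}`, the potential of
the scatterer pinned at `x₀ = (L₀ + R + 1)(1,1,1)` integrates to zero against `|Ψ^per|²` on the cell
(on the cell `Ψ^per = Ψ`, which vanishes off the box, where the potential vanishes). [folklore] -/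
theorem lintegral_impurity_toPeriodic_eq_zero {v : ℝ → ℝ≥0∞} {L₀ R L : ℝ}
    (hv : ∀ r, R < r → v r = 0) (hR : 0 ≤ R) (hL : 0 < L) (hL₀ : L₀ ≤ L)
    (hLL : L₀ + 2 * R + 2 ≤ L) (Ψ : TrialState N L₀) :
    ∫⁻ X in cellN N L, (∑ j : Fin N, periodizedPotential v L
        (X j - (WithLp.toLp 2 fun _ : Fin 3 => L₀ + R + 1 : Space))) *
      (‖(Ψ.toPeriodic hL hL₀).ψ X‖₊ : ℝ≥0∞) ^ 2 = 0 := by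
  rw [setLIntegral_congr_fun (measurableSet_cellN N L) (g := fun _ => 0) ?_]
  · exact lintegral_zero
  · intro X hX
    show (∑ j : Fin N, periodizedPotential v L
        (X j - (WithLp.toLp 2 fun _ : Fin 3 => L₀ + R + 1 : Space))) *
      (‖periodize L Ψ.ψ X‖₊ : ℝ≥0∞) ^ 2 = 0
    rw [periodize_of_mem_cellN hL Ψ.ψ hX]
    by_cases hbox : X ∈ boxN N L₀
    · rw [Finset.sum_eq_zero fun j _ =>
        periodizedPotential_sub_shift_eq_zero hv hR hL hLL (hbox j), zero_mul]
    · rw [Ψ.eq_zero X hbox]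
      simp

/-- **`E_imp(N, L, x₀) ≤ E₀^D(N, L₀)`**: for `v` of range `R ≥ 0`, `0 < L`, `L₀ ≤ L` and
`L₀ + 2R + 2 ≤ L`, the pinned-scatterer infimum on the torus of side `L` with the scatterer at
`x₀ = (L₀ + R + 1)(1,1,1)` is at most the Dirichlet ground-state energy of the box `Λ_{L₀}`
(periodise the Dirichlet trial states: no image interactions, no impurity term). [folklore] -/
theorem impurityPeriodicGroundStateEnergy_shift_le_groundStateEnergy {v : ℝ → ℝ≥0∞} {L₀ R L : ℝ}
    (hv : ∀ r, R < r → v r = 0) (hR : 0 ≤ R) (hL : 0 < L) (hL₀ : L₀ ≤ L)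
    (hLL : L₀ + 2 * R + 2 ≤ L) (N : ℕ) :
    impurityPeriodicGroundStateEnergy v N L (WithLp.toLp 2 fun _ : Fin 3 => L₀ + R + 1) ≤
      groundStateEnergy v N L₀ := by
  refine le_iInf fun Ψ => ?_
  refine (impurityPeriodicGroundStateEnergy_le v _ (Ψ.toPeriodic hL hL₀)).trans ?_
  rw [impurityPeriodicEnergy_def, lintegral_impurity_toPeriodic_eq_zero hv hR hL hL₀ hLL Ψ, add_zero]
  exact Ψ.periodicEnergy_toPeriodic_le hv hL hL₀ (by linarith)

/-- The same bound with the scatterer at the origin (translation invariance on the torus,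
`impurityPeriodicGroundStateEnergy_eq_of_position`). [folklore] -/
theorem impurityPeriodicGroundStateEnergy_zero_le_groundStateEnergy {v : ℝ → ℝ≥0∞} {L₀ R L : ℝ}
    (hv : ∀ r, R < r → v r = 0) (hR : 0 ≤ R) (hL : 0 < L) (hL₀ : L₀ ≤ L)
    (hLL : L₀ + 2 * R + 2 ≤ L) (N : ℕ) :
    impurityPeriodicGroundStateEnergy v N L 0 ≤ groundStateEnergy v N L₀ := by
  rw [impurityPeriodicGroundStateEnergy_eq_of_position v N L 0
    (WithLp.toLp 2 fun _ : Fin 3 => L₀ + R + 1)]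
  exact impurityPeriodicGroundStateEnergy_shift_le_groundStateEnergy hv hR hL hL₀ hLL N

/-! ### Along the box sequences -/

/-- The box side `L_N(ρ) = (N/ρ)^{1/3}` is monotone in `N`. [folklore] -/
theorem sideLength_le_sideLength_succ {ρ : ℝ} (hρ : 0 < ρ) (N : ℕ) :
    sideLength ρ N ≤ sideLength ρ (N + 1) := by
  unfold sideLength
  refine Real.rpow_le_rpow (div_nonneg N.cast_nonneg hρ.le) ?_ (by norm_num)
  exact div_le_div_of_nonneg_right (by push_cast; linarith) hρ.le

/-- **Finite pinned-scatterer energies at small density, eventually — hard cores included.**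
For every repulsive finite-range `v` there is `ρ₁ > 0` such that for `0 < ρ < ρ₁`, for all large `N`,
the pinned-scatterer ground-state energy of `N` bosons on the torus of side `sideLength ρ (N + 1)`
with the scatterer at the origin is finite:
`impurityPeriodicGroundStateEnergy v N (sideLength ρ (N + 1)) 0 < ⊤`. With `R > 0` a range of `v`,
`ρ₁ = 1/(2(1 + R)³)` works: the Dirichlet energy at the double density is finite eventually
(`limsup_lt_top_of_small`) and its box fits, with padding `2R + 2`, into the torus
(`tendsto_sideLength_sub_sideLength`). This is the hidden finiteness content of the crux
`CloudMomentumAtom` and of the stub `stub_andersonFidelity` (old item stmt-AtomisticToContinuum-3909).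
[folklore] -/
theorem eventually_impurityPeriodicGroundStateEnergy_lt_top {v : ℝ → ℝ≥0∞}
    (hv : IsRepulsiveFiniteRange v) :
    ∃ ρ₁ : ℝ, 0 < ρ₁ ∧ ∀ ρ : ℝ, 0 < ρ → ρ < ρ₁ →
      ∀ᶠ N : ℕ in atTop, impurityPeriodicGroundStateEnergy v N (sideLength ρ (N + 1)) 0 < ⊤ := by
  obtain ⟨R, hR, hv0⟩ := hv.exists_pos_range
  refine ⟨1 / (2 * (1 + R) ^ 3), by positivity, fun ρ hρ hρ₁ => ?_⟩
  have h2ρ : 0 < 2 * ρ := by positivity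
  have hsmall : 2 * ρ * (1 + R) ^ 3 < 1 := by
    rw [lt_div_iff₀ (by positivity)] at hρ₁
    linarith
  have hfin := limsup_lt_top_of_small hv.1 hv0 hR h2ρ hsmall
  have hevD : ∀ᶠ N : ℕ in atTop, energyPerParticleDirichlet v (2 * ρ) N < ⊤ :=
    eventually_lt_of_limsup_lt hfin
  have hdrift := (tendsto_sideLength_sub_sideLength hρ (by linarith : ρ < 2 * ρ)).eventually_ge_atTop
    (2 * R + 2)
  filter_upwards [hevD, hdrift, eventually_gt_atTop 0] with N hD hNdrift hN
  -- the Dirichlet energy at the double density is finite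
  have hED : groundStateEnergy v N (sideLength (2 * ρ) N) < ⊤ := by
    unfold energyPerParticleDirichlet at hD
    by_contra htop
    rw [not_lt, top_le_iff] at htop
    rw [htop, ENNReal.top_div_of_ne_top (ENNReal.natCast_ne_top N)] at hD
    exact lt_irrefl _ hD
  -- the geometry of the two boxes
  have hL : 0 < sideLength ρ (N + 1) := by
    unfold sideLength
    exact Real.rpow_pos_of_pos (div_pos (by positivity) hρ) _
  have hLL : sideLength (2 * ρ) N + 2 * R + 2 ≤ sideLength ρ (N + 1) := by
    have h1 := sideLength_le_sideLength_succ hρ N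
    linarith
  have hL₀ : sideLength (2 * ρ) N ≤ sideLength ρ (N + 1) := by linarith
  exact (impurityPeriodicGroundStateEnergy_zero_le_groundStateEnergy hv0 hR.le hL hL₀ hLL N).trans_lt
    hED

/-! ### The registered stub -/

/-- **Stub 0 `stub_impurityEnergyFinite` — finite pinned-scatterer energies at small density, hard
cores included** (statement verbatim from the reshaped, checked skeleton of the line `registered`
(birth) of crux `CloudMomentumAtom`): for every repulsive finite-range `v` there is `ρ₁ > 0` such that
for `0 < ρ < ρ₁`, eventually in `N`, `impurityPeriodicGroundStateEnergy v N (sideLength ρ (N + 1)) 0 < ⊤`.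
This is `eventually_impurityPeriodicGroundStateEnergy_lt_top`. [cite: Ruelle1969, §3.5.11] -/
theorem stub_impurityEnergyFinite :
    ∀ (v : ℝ → ℝ≥0∞), IsRepulsiveFiniteRange v →
      ∃ ρ₁ : ℝ, 0 < ρ₁ ∧ ∀ ρ : ℝ, 0 < ρ → ρ < ρ₁ → ∀ᶠ N : ℕ in atTop,
        impurityPeriodicGroundStateEnergy v N (sideLength ρ (N + 1)) 0 < ⊤ :=
  fun _ hv => eventually_impurityPeriodicGroundStateEnergy_lt_top hv

/-! ### The composition of the line (sorry-free logic) -/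

/-- **Adapter (pure logic): finiteness + Anderson-fidelity-given-finiteness give the original
Anderson-fidelity statement** (stub 1 of the birth skeleton, verbatim): `ρ₀ := min`, intersect the
two eventual-`N` sets, and `E^per ≤ E_imp < ⊤`
(`periodicGroundStateEnergy_le_impurityPeriodicGroundStateEnergy`). [folklore] -/
theorem andersonFidelity_of_finite
    (h0 : ∀ (v : ℝ → ℝ≥0∞), IsRepulsiveFiniteRange v →
      ∃ ρ₁ : ℝ, 0 < ρ₁ ∧ ∀ ρ : ℝ, 0 < ρ → ρ < ρ₁ → ∀ᶠ N : ℕ in atTop,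
        impurityPeriodicGroundStateEnergy v N (sideLength ρ (N + 1)) 0 < ⊤)
    (h1 : ∀ (v : ℝ → ℝ≥0∞), IsRepulsiveFiniteRange v → ∀ ε : ℝ, 0 < ε →
      ∃ ρ₀ : ℝ, 0 < ρ₀ ∧ ∀ ρ : ℝ, 0 < ρ → ρ < ρ₀ → ∀ᶠ N : ℕ in atTop,
        ∀ L : ℝ, L = sideLength ρ (N + 1) →
          periodicGroundStateEnergy v N L ≠ ⊤ →
          impurityPeriodicGroundStateEnergy v N L 0 ≠ ⊤ →
          ∃ δ : ℝ≥0∞, 0 < δ ∧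
            ∀ Φ : PeriodicTrialState N L,
              impurityPeriodicEnergy v 0 Φ ≤ impurityPeriodicGroundStateEnergy v N L 0 + δ →
            ∀ Ψ : PeriodicTrialState N L,
              periodicEnergy v Ψ ≤ periodicGroundStateEnergy v N L + δ →
              ENNReal.ofReal (1 - ε) ≤
                (‖∫ X in cellN N L, conj (Ψ.ψ X) * Φ.ψ X‖₊ : ℝ≥0∞) ^ 2) :
    ∀ (v : ℝ → ℝ≥0∞), IsRepulsiveFiniteRange v → ∀ ε : ℝ, 0 < ε →
      ∃ ρ₀ : ℝ, 0 < ρ₀ ∧ ∀ ρ : ℝ, 0 < ρ → ρ < ρ₀ → ∀ᶠ N : ℕ in atTop,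
        ∀ L : ℝ, L = sideLength ρ (N + 1) →
          ∃ δ : ℝ≥0∞, 0 < δ ∧
            ∀ Φ : PeriodicTrialState N L,
              impurityPeriodicEnergy v 0 Φ ≤ impurityPeriodicGroundStateEnergy v N L 0 + δ →
            ∀ Ψ : PeriodicTrialState N L,
              periodicEnergy v Ψ ≤ periodicGroundStateEnergy v N L + δ →
              ENNReal.ofReal (1 - ε) ≤
                (‖∫ X in cellN N L, conj (Ψ.ψ X) * Φ.ψ X‖₊ : ℝ≥0∞) ^ 2 := by
  intro v hv ε hε
  obtain ⟨ρ₁, hρ₁, H0⟩ := h0 v hv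
  obtain ⟨ρ₂, hρ₂, H1⟩ := h1 v hv ε hε
  refine ⟨min ρ₁ ρ₂, lt_min hρ₁ hρ₂, fun ρ hρ hρlt => ?_⟩
  filter_upwards [H0 ρ hρ (hρlt.trans_le (min_le_left _ _)),
    H1 ρ hρ (hρlt.trans_le (min_le_right _ _))] with N hN0 hN1
  intro L hL
  have hI : impurityPeriodicGroundStateEnergy v N L 0 ≠ ⊤ := by rw [hL]; exact hN0.ne
  have hF : periodicGroundStateEnergy v N L ≠ ⊤ :=
    ne_top_of_le_ne_top hI (periodicGroundStateEnergy_le_impurityPeriodicGroundStateEnergy v N L 0)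
  exact hN1 L hL hF hI

/-- **Composition, hypotheses form** (verbatim from the checked birth skeleton). The statements of
the three birth stubs — Anderson fidelity (`h1`), free zero momentum (`h2`), projection transfer
(`h3`) — imply the body of the crux `CloudMomentumAtom`. Pure logic + `min`: `h1` at `ε/2`, `h2` at
`ε²/16`, `ρ₀ = min ρ₁ ρ₂`, intersect the eventual-`N` sets, `δ = min δ₁ δ₂`, pick a free
`δ`-near-minimiser `Ψ` (it exists: if the free infimum is `⊤` every state is one, else `iInf_lt_iff`),
and close with `h3`. [folklore] -/
theorem cloudMomentumAtom_of_stubs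
    (h1 : ∀ (v : ℝ → ℝ≥0∞), IsRepulsiveFiniteRange v → ∀ ε : ℝ, 0 < ε →
      ∃ ρ₀ : ℝ, 0 < ρ₀ ∧ ∀ ρ : ℝ, 0 < ρ → ρ < ρ₀ → ∀ᶠ N : ℕ in atTop,
        ∀ L : ℝ, L = sideLength ρ (N + 1) →
          ∃ δ : ℝ≥0∞, 0 < δ ∧
            ∀ Φ : PeriodicTrialState N L,
              impurityPeriodicEnergy v 0 Φ ≤ impurityPeriodicGroundStateEnergy v N L 0 + δ →
            ∀ Ψ : PeriodicTrialState N L,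
              periodicEnergy v Ψ ≤ periodicGroundStateEnergy v N L + δ →
              ENNReal.ofReal (1 - ε) ≤
                (‖∫ X in cellN N L, conj (Ψ.ψ X) * Φ.ψ X‖₊ : ℝ≥0∞) ^ 2)
    (h2 : ∀ (v : ℝ → ℝ≥0∞), IsRepulsiveFiniteRange v → ∀ ε : ℝ, 0 < ε →
      ∃ ρ₀ : ℝ, 0 < ρ₀ ∧ ∀ ρ : ℝ, 0 < ρ → ρ < ρ₀ → ∀ᶠ N : ℕ in atTop,
        ∀ L : ℝ, L = sideLength ρ (N + 1) →
          ∃ δ : ℝ≥0∞, 0 < δ ∧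
            ∀ Ψ : PeriodicTrialState N L,
              periodicEnergy v Ψ ≤ periodicGroundStateEnergy v N L + δ →
              ENNReal.ofReal ((1 - ε) * L ^ 6) ≤
                ∫⁻ X in cellN N L, (‖∫ t in cell L, Ψ.ψ (X + fun _ => t)‖₊ : ℝ≥0∞) ^ 2)
    (h3 : ∀ (N : ℕ) (L : ℝ), 0 < L → ∀ ε : ℝ, 0 < ε → ∀ Φ Ψ : PeriodicTrialState N L,
      ENNReal.ofReal (1 - ε / 2) ≤ (‖∫ X in cellN N L, conj (Ψ.ψ X) * Φ.ψ X‖₊ : ℝ≥0∞) ^ 2 →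
      ENNReal.ofReal ((1 - ε ^ 2 / 16) * L ^ 6) ≤
        ∫⁻ X in cellN N L, (‖∫ t in cell L, Ψ.ψ (X + fun _ => t)‖₊ : ℝ≥0∞) ^ 2 →
      ENNReal.ofReal ((1 - ε) * L ^ 6) ≤
        ∫⁻ X in cellN N L, (‖∫ t in cell L, Φ.ψ (X + fun _ => t)‖₊ : ℝ≥0∞) ^ 2) :
    ∀ v : ℝ → ℝ≥0∞, IsRepulsiveFiniteRange v → ∀ ε : ℝ, 0 < ε → ∃ ρ₀ : ℝ, 0 < ρ₀ ∧
      ∀ ρ : ℝ, 0 < ρ → ρ < ρ₀ → ∀ᶠ N : ℕ in atTop, ∃ δ : ℝ≥0∞, 0 < δ ∧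
        ∀ Φ : PeriodicTrialState N (sideLength ρ (N + 1)),
          impurityPeriodicEnergy v 0 Φ ≤
              impurityPeriodicGroundStateEnergy v N (sideLength ρ (N + 1)) 0 + δ →
          ENNReal.ofReal ((1 - ε) * sideLength ρ (N + 1) ^ 6) ≤
            ∫⁻ X in cellN N (sideLength ρ (N + 1)),
              (‖∫ t in cell (sideLength ρ (N + 1)), Φ.ψ (X + fun _ => t)‖₊ : ℝ≥0∞) ^ 2 := by
  intro v hv ε hε
  obtain ⟨ρ₁, hρ₁, H1⟩ := h1 v hv (ε / 2) (half_pos hε)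
  obtain ⟨ρ₂, hρ₂, H2⟩ := h2 v hv (ε ^ 2 / 16) (by positivity)
  refine ⟨min ρ₁ ρ₂, lt_min hρ₁ hρ₂, fun ρ hρ hρlt => ?_⟩
  have E1 := H1 ρ hρ (hρlt.trans_le (min_le_left _ _))
  have E2 := H2 ρ hρ (hρlt.trans_le (min_le_right _ _))
  filter_upwards [E1, E2] with N hN1 hN2
  obtain ⟨δ₁, hδ₁, K1⟩ := hN1 _ rfl
  obtain ⟨δ₂, hδ₂, K2⟩ := hN2 _ rfl
  refine ⟨min δ₁ δ₂, lt_min hδ₁ hδ₂, fun Φ hΦ => ?_⟩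
  -- the torus side is positive
  have hL : 0 < sideLength ρ (N + 1) := by
    unfold sideLength
    exact Real.rpow_pos_of_pos (div_pos (by exact_mod_cast Nat.succ_pos N) hρ) _
  -- a free `δ`-near-minimiser exists (if the free infimum is `⊤`, every state is one)
  obtain ⟨Ψ, hΨ⟩ : ∃ Ψ : PeriodicTrialState N (sideLength ρ (N + 1)),
      periodicEnergy v Ψ ≤ periodicGroundStateEnergy v N (sideLength ρ (N + 1)) + min δ₁ δ₂ := by
    by_cases htop : periodicGroundStateEnergy v N (sideLength ρ (N + 1)) = ⊤
    · exact ⟨Φ, by rw [htop, top_add]; exact le_top⟩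
    · have hlt : periodicGroundStateEnergy v N (sideLength ρ (N + 1)) <
          periodicGroundStateEnergy v N (sideLength ρ (N + 1)) + min δ₁ δ₂ :=
        ENNReal.lt_add_right htop (lt_min hδ₁ hδ₂).ne'
      have hlt' := hlt
      conv_lhs at hlt' => unfold periodicGroundStateEnergy
      obtain ⟨Ψ, hΨ⟩ := iInf_lt_iff.mp hlt'
      exact ⟨Ψ, hΨ.le⟩
  have hΦ₁ : impurityPeriodicEnergy v 0 Φ ≤
      impurityPeriodicGroundStateEnergy v N (sideLength ρ (N + 1)) 0 + δ₁ :=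
    hΦ.trans (add_le_add le_rfl (min_le_left _ _))
  have hΨ₁ : periodicEnergy v Ψ ≤ periodicGroundStateEnergy v N (sideLength ρ (N + 1)) + δ₁ :=
    hΨ.trans (add_le_add le_rfl (min_le_left _ _))
  have hΨ₂ : periodicEnergy v Ψ ≤ periodicGroundStateEnergy v N (sideLength ρ (N + 1)) + δ₂ :=
    hΨ.trans (add_le_add le_rfl (min_le_right _ _))
  exact h3 N _ hL ε hε Φ Ψ (K1 Φ hΦ₁ Ψ hΨ₁) (K2 Ψ hΨ₂)

/-- **`AndersonFidelityOfFinite → CloudMomentumAtom` — the crux reduced to its one open stub.**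
The crux `Summit.AtomisticToContinuum.BoseEinsteinCondensation.Theses.BECProbeMassFlow.CloudMomentumAtom`
(concluded BY NAME) follows from the single remaining registered stub of the line, the
Anderson-fidelity statement with finite energies supplied (`h1'`: at small density, eventually in `N`,
on the torus of side `sideLength ρ (N + 1)` with `E^per, E_imp < ⊤`, with a slack `δ` chosen after `N`,
every `δ`-near-minimiser `Φ` of the pinned-scatterer energy and every `δ`-near-minimiser `Ψ` of the
free periodic energy satisfy `1 − ε ≤ |⟨Ψ, Φ⟩|²`) — by `cloudMomentumAtom_of_stubs` with the three
LANDED stubs `stub_impurityEnergyFinite` (this file), `stub_freeZeroMomentum` and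
`stub_projectionTransfer` plugged in. Kernel-checked reduction "crux ⟸ Transfer `C⁺`" of route
`BECProbeMassFlow` (two-layer plan `AndersonFidelity → ProjectionGlue → CloudMomentumAtom`, with
`ProjectionGlue` and the finiteness now proved). [folklore] -/
theorem cloudMomentumAtom_of_andersonFidelityOfFinite
    (h1' : ∀ (v : ℝ → ℝ≥0∞), IsRepulsiveFiniteRange v → ∀ ε : ℝ, 0 < ε →
      ∃ ρ₀ : ℝ, 0 < ρ₀ ∧ ∀ ρ : ℝ, 0 < ρ → ρ < ρ₀ → ∀ᶠ N : ℕ in atTop,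
        ∀ L : ℝ, L = sideLength ρ (N + 1) →
          periodicGroundStateEnergy v N L ≠ ⊤ →
          impurityPeriodicGroundStateEnergy v N L 0 ≠ ⊤ →
          ∃ δ : ℝ≥0∞, 0 < δ ∧
            ∀ Φ : PeriodicTrialState N L,
              impurityPeriodicEnergy v 0 Φ ≤ impurityPeriodicGroundStateEnergy v N L 0 + δ →
            ∀ Ψ : PeriodicTrialState N L,
              periodicEnergy v Ψ ≤ periodicGroundStateEnergy v N L + δ →
              ENNReal.ofReal (1 - ε) ≤
                (‖∫ X in cellN N L, conj (Ψ.ψ X) * Φ.ψ X‖₊ : ℝ≥0∞) ^ 2) :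
    Summit.AtomisticToContinuum.BoseEinsteinCondensation.Theses.BECProbeMassFlow.CloudMomentumAtom :=
  cloudMomentumAtom_of_stubs (andersonFidelity_of_finite stub_impurityEnergyFinite h1')
    stub_freeZeroMomentum stub_projectionTransfer

end Summit.AtomisticToContinuum.BoseEinsteinCondensation.Cruxes.CloudMomentumAtom.Birth

end
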